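import Literature.AlgebraicGeometry.Frobenioids.PadicFrobenioidMonogenic
import Literature.AlgebraicGeometry.Frobenioids.PadicFrobenioidUnitSplittings
import Literature.AlgebraicGeometry.Frobenioids.PadicFrobenioidZeroMonoid
import HarnessLib

/-!
# Frobenioids II, Example 1.1 (ii): the split monogenic `p`-adic Frobenioid `(C^c, τ_c)` of a constant section

Mochizuki, *The geometry of Frobenioids II*, Kyushu J. Math. **62** (2008) 401–460, §1, Example 1.1 (ii) p. 8
and Theorem 1.2 (v) p. 9 (proof p. 10: "the image of `p ∈ ℚ_p^×` in `K^×` … determines a characteristic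
splitting") [cite: MochizukiFrdII2008, Thm 1.2 (v) pp.9-10]; at a bad place of [IUTchI] §3 the same
construction with `q_v` in place of `p` is Ex. 3.2 (v): "`Φ_{C_v^⊢} := ℕ · log_Φ(q_v)|_{D_v^⊢}` … determines a
`p_v`-adic Frobenioid … `q_v` determines a `μ_{2l}(−)`-orbit of characteristic splittings `τ_v^⊢` … a split
Frobenioid `F_v^⊢ = (C_v^⊢, τ_v^⊢)`".

Consequences for the monogenic datum `Datum.monogenic` of a constant section `c` (`PadicFrobenioidMonogenic.lean`)
of the results of this directory (instantiations only):

* `Datum.monogenic_isSplittingFamily` — `c|_{K^×}` is a splitting family of the monogenic datum, hence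
  **`Datum.monogenicSplitting` — the characteristic splitting `τ_c` determined by `c`** (abc-iut-L1-t4's
  `Datum.cSplitting`; no absolute primitivity needed);
* `Datum.monogenic_isMonoidData` — over a base of FSM-type, `Φ^c`, `B^c` are monoids on `D`
  (`Datum.isMonoidOn_monogenicΦ` over every base);
* `Datum.monogenic_hasBijectivePullbacks`.
-/

noncomputable section

namespace Literature.AlgebraicGeometry.Frobenioids

namespace PadicFrd

open CategoryTheory Opposite Function

universe v u

variable {D : Type u} [Category.{v} D] {p : ℕ} [Fact p.Prime] (base : D ⥤ PadicFld.{u} p)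
  {c : ∀ A : D, intNonzero (base.obj A).K} (hcs : Monogenic.IsConstantSection base c)
  (hloc : ∀ A : D, (base.obj A).IsPadicLocal) (hc : IsConnected D) (he : IsTotallyEpimorphic D)

namespace Datum

/-! ### The characteristic splitting `τ_c` -/

/-- `c|_{K^×}` is a splitting family of the monogenic datum generated by `c` (compatible, of valuation `< 1`,
`Div₀(c_A)` generates `ι(Φ^c(A))`). [cite: MochizukiFrdII2008, Thm 1.2 (v) p.10] -/
theorem monogenic_isSplittingFamily :
    (Datum.monogenic base hcs hloc hc he).IsSplittingFamily fun A => intNonzeroToUnits (base.obj A).K (c A) :=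
  ⟨fun f => hcs.units_map_eq base f, fun A => hcs.valuation_lt_one base A,
    fun A z => Datum.monogenic_generates base hcs hloc hc he A z⟩

/-- **`τ_c`: the characteristic splitting determined by the constant section `c`** on the Frobenioid of the
monogenic datum — base-identity linear endomorphisms whose rational function restricted to `K_{A_D}^×` is a
power of `c_{A_D}` ([FrdI] Def. 2.3, all fields PROVED via `Datum.cSplitting`); for `c = q_v` this is (a
member of the `μ_{2l}`-orbit) `τ_v^⊢` of [IUTchI] Ex. 3.2 (v), for `c = p_v` it is `τ_{p_v}` of Ex. 3.3 (ii).
[cite: MochizukiFrdII2008, Thm 1.2 (v) p.10] -/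
def monogenicSplitting :
    PreFrobenioid.CharacteristicSplitting (Datum.monogenic base hcs hloc hc he).structureFunctor :=
  (Datum.monogenic base hcs hloc hc he).cSplitting (monogenic_isSplittingFamily base hcs hloc hc he)

/-- The `τ`-component of `τ_c`. [cite: MochizukiFrdII2008, Thm 1.2 (v) p.10] -/
@[simp] theorem monogenicSplitting_τ :
    (monogenicSplitting base hcs hloc hc he).τ =
      (Datum.monogenic base hcs hloc hc he).cSplittingSubmonoid fun A => intNonzeroToUnits (base.obj A).K (c A) :=
  rfl

/-! ### `Φ^c`, `B^c` are monoids on `D` -/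

/-- The underlying map of an isomorphism of `CommMonCat` is bijective. [cite: MochizukiFrdI2008, Def. 1.1(ii) p.19] -/
private theorem bijective_hom_of_isIso'' {X Y : CommMonCat.{u}} (f : X ⟶ Y) [IsIso f] : Bijective f.hom := by
  refine Function.bijective_iff_has_inverse.mpr ⟨(inv f).hom, fun x => ?_, fun y => ?_⟩
  · change (f ≫ inv f).hom x = x
    rw [IsIso.hom_inv_id]
    rfl
  · change (inv f ≫ f).hom y = y
    rw [IsIso.inv_hom_id]
    rfl

/-- `Φ^c` is a monoid on `D` ([FrdI] Def. 1.1 (ii)) over EVERY base: bijective, hence characteristically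
injective, pull-backs (`Φ^c(A) ≅ ℤ_{≥0}` is sharp). [cite: MochizukiFrdII2008, Ex 1.1 (ii) p.8] -/
theorem isMonoidOn_monogenicΦ : IsMonoidOn (Datum.monogenic base hcs hloc hc he).Φ := by
  refine ⟨fun {A B} g => ?_, fun {A B} g _ => ?_⟩
  · have hsharp : IsSharp ((Datum.monogenic base hcs hloc hc he).Φ.obj (op B)) :=
      ((Datum.monogenic base hcs hloc hc he).isMonoprime (op B)).isSharp
    exact isCharInjective_of_injective_of_isSharp _ (monogenic_map_Φ_bijective base hcs hloc hc he g).1 hsharp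
  · exact monogenic_map_Φ_bijective base hcs hloc hc he g

/-- The pull-back maps of `B^c` are injective (an element is determined by its `K^×`-component, on which the
pull-back is the injective `K_A^× → K_B^×`). [cite: MochizukiFrdII2008, Ex 1.1 (ii) p.8] -/
theorem monogenic_map_B_injective {A B : D} (g : B ⟶ A) :
    Injective ((Datum.monogenic base hcs hloc hc he).B.map g.op).hom := by
  intro b b' h
  have h1 : Units.map ((base.map g).alg : (base.obj A).K →* (base.obj B).K) b.1.1 =
      Units.map ((base.map g).alg : (base.obj A).K →* (base.obj B).K) b'.1.1 :=
    congrArg (fun q : Monogenic.BSub base hcs (op B) => q.1.1) h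
  have hx : b.1.1 = b'.1.1 :=
    Units.map_injective (f := ((base.map g).alg : (base.obj A).K →* (base.obj B).K)) (base.map g).alg.injective h1
  haveI : IsCancelMul ((phiZeroOn base).obj (op A)) := isCancelMul_realification (OrdInt (base.obj A).K)
  have hι : Injective (MonGp.map ((Monogenic.ιc base hcs).app (op A)).hom) :=
    MonGp.map_injective _ (Monogenic.ι_injective base hcs _)
  have hγ : b.1.2 = b'.1.2 := by
    apply hι
    have hb : ((divZeroOn base).app (op A)).hom b.1.1 =
        MonGp.map ((Monogenic.ιc base hcs).app (op A)).hom b.1.2 := b.2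
    have hb' : ((divZeroOn base).app (op A)).hom b'.1.1 =
        MonGp.map ((Monogenic.ιc base hcs).app (op A)).hom b'.1.2 := b'.2
    rw [← hb, ← hb', hx]
  exact Subtype.ext (Prod.ext hx hγ)

/-- Over a base of FSM-type, `B^c` is a monoid on `D`. [cite: MochizukiFrdII2008, Ex 1.1 (ii) p.8] -/
theorem isMonoidOn_monogenicB (hD : IsOfFSMType D) : IsMonoidOn (Datum.monogenic base hcs hloc hc he).B := by
  refine ⟨fun {A B} g => ⟨monogenic_map_B_injective base hcs hloc hc he g, ?_⟩, fun {A B} g hg => ?_⟩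
  · haveI : Subsingleton (Associates ((Datum.monogenic base hcs hloc hc he).B.obj (op A))) := ⟨fun x y => by
      obtain ⟨a, rfl⟩ := Associates.mk_surjective x
      obtain ⟨b, rfl⟩ := Associates.mk_surjective y
      obtain ⟨ua, hua⟩ := (Datum.monogenic base hcs hloc hc he).isUnit_B (op A) a
      obtain ⟨ub, hub⟩ := (Datum.monogenic base hcs hloc hc he).isUnit_B (op A) b
      exact Associates.mk_eq_mk_iff_associated.mpr
        ⟨ua⁻¹ * ub, by rw [← hua, Units.val_mul, ← mul_assoc, Units.mul_inv, one_mul, hub]⟩⟩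
    exact injective_of_subsingleton _
  · haveI : IsIso g := hD.isIso_of_isFSM g hg
    haveI : IsIso ((Datum.monogenic base hcs hloc hc he).B.map g.op) := inferInstance
    exact bijective_hom_of_isIso'' _

/-- **`IsMonoidData` holds for the monogenic datum** over a base of FSM-type: "`Φ`, `B` are monoids on `D`"
([FrdI] Thm. 5.2). [cite: MochizukiFrdII2008, Ex 1.1 (ii) p.8] -/
theorem monogenic_isMonoidData (hD : IsOfFSMType D) : (Datum.monogenic base hcs hloc hc he).IsMonoidData :=
  ⟨isMonoidOn_monogenicΦ base hcs hloc hc he, isMonoidOn_monogenicB base hcs hloc hc he hD⟩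

/-- All pull-back maps of `Φ^c` are bijective (the constancy hypothesis of reading (R1) of Rmk. 1.2.2).
[cite: MochizukiFrdII2008, Rmk 1.2.2 p.10] -/
theorem monogenic_hasBijectivePullbacks : (Datum.monogenic base hcs hloc hc he).HasBijectivePullbacks :=
  fun f => monogenic_map_Φ_bijective base hcs hloc hc he f

end Datum

end PadicFrd

end Literature.AlgebraicGeometry.Frobenioids
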